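import Summits.PneNP.PneNP.Theorems.ChebyshevTracialDesignPsdAssembly
import Summits.PneNP.PneNP.Theorems.ChebyshevTracialDesignRectangleDecayAll
import Summits.PneNP.PneNP.Theses.ChebyshevTracialDesign
import HarnessLib

/-!
# Cell pnp-psdrank, route `ChebyshevTracialDesign`: the crux from its dense non-crossing psd cell AT THE EXPONENTIAL SCALE —
# the weakest form of the dense-cell hypothesis the reduction accepts (value ≤ B·e^{−c₀·dq m}·r at trace densities ≥ e^{−c₀·dq m}), budgeted

Leaf file for the crux `TracialDecayExp20` (stmt-PneNP-19878), brick 57 (prover g11), refining bricks 54/55 (`…PsdCrux`, `…PsdCruxBudget`). There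
the dense non-crossing psd cell was asked to have value `≤ B·e^{2000}·√P*·r` (`P* ≈ n^{−(D−q)/4}`, the scale the `r = 1` supplier brick 50b happens to
deliver). The assembly needs much less: the dense-cell term enters the three-term bound as `2·4^q·e^{q+1}·Ψ` and the junk threshold is already
`β = e^{−c₀(dq n − 1)}`, so `Ψ := β` is absorbed by the same junk estimate (`…RectangleDecayAll.junk_term_le'`). Hence the EXP-SCALE DENSE CELL suffices:
  «∃ c₀ ∈ (0,1], n₀: in every reduced instance K_m (n − dq n ≤ m ≤ n), every tight psd strategy of dimension r [with the side condition P n r] on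
   t''-cuts × a family whose trace weight tr(Y'_M)/r is (PM_m, e)-homogeneous, with both trace densities ≥ e^{−c₀·dq m}, has value
   ≤ B·e^{−c₀·dq m}·r against every reduced design of degree D' ∈ [D − q, D]»
— value at most `B·r` times the density threshold, at the same rate `c₀`.
* §1 **`tracialDecayExp_of_psdDenseCellExpP`** — for any side condition `P : ℕ → ℕ → Prop`: the exp-scale dense cell for the `r` with `P n r` ⇒
  `∃ a > 0` (`= c₀/80`), `n₁`: `TracialValueLEAt (levelWeight n t C w) (B·exp(−a·dq n)) r` for every even `n ≥ n₁`, every exact design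
  (`t = 2c'+1` balanced, `T ≤ Tq n`, `dq n − 2 ≤ D ≤ dq n`) and every `r ≥ 1` with `P n r`;
* §2 **`tracialDecayExp20_of_psdDenseCellExp`** — with `P n r := r²·n < exp(a₁·dq n)`: the exp-scale dense cell inside the budget ⇒ `TracialDecayExp20`
  by name (rate `min(c₀/160, a₁)`).
[cite: Rothvoss2017, §2 and Lemma 7 (PDF pp. 6–8)] [cite: KupavskiiZakharov2022, Lemma 11] [cite: BrietDadushPokutta2014, Thm. 6 (§3)]
Stature: support/instrument — CONDITIONAL reduction (the exp-scale dense cell is open for `r > 1`; for `r = 1` it follows from brick 50b modulo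
Keevash–Lifshitz). WHAT THIS IS NOT: not a proof of `TracialDecayExp20`, nothing on psd rank, no P-vs-NP content. Supports stmt-PneNP-19878.
-/

set_option linter.dupNamespace false -- `Summit.PneNP.PneNP.…`: summit = sub-problem (D-0017)

noncomputable section

namespace Summit.PneNP.PneNP.Theorems.ChebyshevTracialDesignPsdCruxExp

open Finset Matrix Literature.Combinatorics.Optimization
open Literature.Barriers.PneNP hiding verts
open Literature.Combinatorics.SetFamily
open Literature.Combinatorics.SimpleGraph.CycleSpace
open Literature.Combinatorics.AssociationSchemes.HomogeneousMatchingFamilies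
open Summit.PneNP.PneNP.Theorems.ChebyshevTracialDesignSpectralNonTightnessEstimates (atten_le_pow atten_nonneg)
open Summit.PneNP.PneNP.Theorems.ChebyshevTracialDesignRungConstants (remainder_term_le crossing_term_le)
open Summit.PneNP.PneNP.Theorems.ChebyshevTracialDesignReducedSpreadCell (dq_pred_le)
open Summit.PneNP.PneNP.Theorems.ChebyshevTracialDesignRectangleDecayAll (junk_term_le')
open Summit.PneNP.PneNP.Theorems.ChebyshevTracialDesignPsdAssembly (tracialValueLEAt_of_psdDenseCell)

variable {n : ℕ}

/-! ### §1 The psd rung with constants, modulo the EXP-SCALE dense non-crossing psd cell (side condition on the dimension) -/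

set_option maxHeartbeats 600000 in
/-- **EVERY EXACT DESIGN OF DEGREE `≍ dq n` HAS TRACIAL VALUE `≤ B_v·exp(−a·dq n)` AT EVERY DIMENSION `r` WITH `P n r`, modulo the EXP-SCALE
dense non-crossing psd cell at those dimensions** (value `≤ B·e^{−c₀·dq m}·r` at trace densities `≥ e^{−c₀·dq m}`). Same reduction and constants as
bricks 54/55 (`τ = e`, `q = ⌈a·dq n⌉+4`, `β = e^{−c₀(dq n−1)}`), with the dense-cell term absorbed by the junk estimate (`Ψ := β`).
[cite: Rothvoss2017, §2 and Lemma 7 (PDF pp. 6–8)] [cite: KupavskiiZakharov2022, Lemma 11] [cite: BrietDadushPokutta2014, Thm. 6 (§3)] -/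
theorem tracialDecayExp_of_psdDenseCellExpP (P : ℕ → ℕ → Prop)
    (hred : ∃ c₀ : ℝ, 0 < c₀ ∧ c₀ ≤ 1 ∧ ∃ n₀ : ℕ, ∀ (n q Dg T : ℕ) (Bv : ℝ) (C : Finset ℕ),
      (∀ c ∈ C, Odd c ∧ 3 ≤ c ∧ c ≤ T) → T * T ≤ 49 * n → 200 * T ≤ n → 40 * q ≤ n → 2 * q ≤ dq n → Dg ≤ dq n → 1 ≤ dq n →
      4 * dq n + 8 ≤ n →
      ∀ (m t'' D' : ℕ) (w' : ℕ → ℝ), n₀ ≤ m → n ≤ m + 2 * q → Even m → Odd t'' → m ≤ 5 * t'' → m ≤ 5 * (m - t'') →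
      T ≤ t'' → T ≤ m - t'' → D' + 3 ≤ t'' → D' + 3 ≤ m - t'' → Dg ≤ D' + q → D' ≤ Dg →
      (∀ c ∈ C, (Qset m t'' c).Nonempty) →
      (∀ p : Polynomial ℝ, p.natDegree ≤ D' → ∑ c ∈ C, w' c * p.eval (c : ℝ) = -p.eval 0) →
      ∑ c ∈ C, |w' c| ≤ Bv →
      ∀ (r : ℕ), P n r → ∀ (X' : OddSet m → Matrix (Fin r) (Fin r) ℝ) (Y' : PMatch m → Matrix (Fin r) (Fin r) ℝ), IsPsdRect X' Y' →
      ∀ (A' : Finset (OddSet m)), (∀ U ∈ A', U.1.card = t'') → ∀ (B' : Finset (PMatch m)),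
      IsRelHomogeneousW (Real.exp 1) (perfectMatchings (univ : Finset (Fin m)))
        (fun M : Finset (Sym2 (Fin m)) => if hM : IsPMOn univ M then (Y' ⟨M, hM⟩).trace / r else 0) (B'.image Subtype.val) →
      Real.exp (-(c₀ * dq m)) ≤ (∑ U ∈ A', (X' U).trace) / ((r : ℝ) * (m.choose t'' : ℝ)) →
      Real.exp (-(c₀ * dq m)) ≤ (∑ M ∈ B', (Y' M).trace) / ((r : ℝ) * (Fintype.card (PMatch m) : ℝ)) →
      ∑ U ∈ A', ∑ M ∈ B', levelWeight m t'' C w' U M * (X' U * Y' M).trace ≤ Bv * Real.exp (-(c₀ * dq m)) * r) :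
    ∃ a : ℝ, 0 < a ∧ ∃ n₁ : ℕ, ∀ n : ℕ, n₁ ≤ n → Even n → ∀ (c' T Dg : ℕ) (Bv : ℝ) (C : Finset ℕ) (w : ℕ → ℝ),
      IsExactDesign n (2 * c' + 1) T Dg Bv C w → n ≤ 4 * (2 * c' + 1) → T ≤ Tq n → dq n ≤ Dg + 2 → Dg ≤ dq n →
        ∀ r : ℕ, 0 < r → P n r → TracialValueLEAt (levelWeight n (2 * c' + 1) C w) (Bv * Real.exp (-(a * (dq n : ℝ)))) r := by
  classical
  have hτ1 : (1 : ℝ) ≤ Real.exp 1 := by have := Real.add_one_le_exp (1 : ℝ); linarith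
  have hτ0 : (0 : ℝ) < Real.exp 1 := Real.exp_pos 1
  obtain ⟨c₀, hc₀, hc₀1, n₀, hred⟩ := hred
  obtain ⟨a, ha⟩ : ∃ a : ℝ, a = c₀ / 80 := ⟨_, rfl⟩
  have ha0 : 0 < a := by rw [ha]; positivity
  obtain ⟨D₁, hD₁⟩ : ∃ D₁ : ℕ, D₁ = max 1000 ⌈6400 / c₀⌉₊ := ⟨_, rfl⟩
  refine ⟨a, ha0, max (2 * n₀ + 28) (D₁ ^ 4), ?_⟩
  intro n hn hev c' T Dg Bv C w hdes hbal hTT hDg2 hDgD r hr hPr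
  have hex := hdes
  -- the size parameter `D = dq n`
  have hN₀ : 2 * n₀ + 28 ≤ n := le_trans (le_max_left _ _) hn
  have hD₁n : D₁ ^ 4 ≤ n := le_trans (le_max_right _ _) hn
  have hD : D₁ ≤ dq n := by
    unfold dq
    rw [Nat.le_sqrt, Nat.le_sqrt]
    calc D₁ * D₁ * (D₁ * D₁) = D₁ ^ 4 := by ring
      _ ≤ n := hD₁n
  have hD1000 : 1000 ≤ dq n := le_trans (by rw [hD₁]; exact le_max_left _ _) hD
  have hDc : ⌈6400 / c₀⌉₊ ≤ dq n := le_trans (by rw [hD₁]; exact le_max_right _ _) hD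
  have hcD : 6400 ≤ c₀ * dq n := by
    have h1 : 6400 / c₀ ≤ (dq n : ℝ) := (Nat.le_ceil _).trans (by exact_mod_cast hDc)
    rwa [div_le_iff₀ hc₀, mul_comm] at h1
  have hD4n : dq n ^ 4 ≤ n := by
    have h1 : dq n * dq n ≤ Nat.sqrt n := Nat.sqrt_le (Nat.sqrt n)
    calc dq n ^ 4 = (dq n * dq n) * (dq n * dq n) := by ring
      _ ≤ Nat.sqrt n * Nat.sqrt n := Nat.mul_le_mul h1 h1
      _ ≤ n := Nat.sqrt_le n
  have hD2 : dq n * dq n ≤ dq n ^ 4 := by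
    calc dq n * dq n = dq n * dq n * 1 := (mul_one _).symm
      _ ≤ dq n * dq n * (dq n * dq n) := Nat.mul_le_mul_left _ (Nat.one_le_iff_ne_zero.2 (by positivity))
      _ = dq n ^ 4 := by ring
  have hDDn : dq n * dq n ≤ n := hD2.trans hD4n
  have h1000D : 1000 * dq n ≤ n := by nlinarith
  have hnD : n < (dq n + 1) ^ 4 := by
    have h1 := Nat.lt_succ_sqrt' n
    have h2 := Nat.lt_succ_sqrt' (Nat.sqrt n)
    have h3 : Nat.sqrt n + 1 ≤ (dq n + 1) ^ 2 := h2
    calc n < (Nat.sqrt n + 1) ^ 2 := h1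
      _ ≤ ((dq n + 1) ^ 2) ^ 2 := Nat.pow_le_pow_left h3 2
      _ = (dq n + 1) ^ 4 := by ring
  have hn16 : (n : ℝ) ≤ 16 * (dq n : ℝ) ^ 4 := by
    have h1 : n ≤ (2 * dq n) ^ 4 := hnD.le.trans (Nat.pow_le_pow_left (by omega) 4)
    have h2 : ((n : ℕ) : ℝ) ≤ (((2 * dq n) ^ 4 : ℕ) : ℝ) := by exact_mod_cast h1
    have h3 : (((2 * dq n) ^ 4 : ℕ) : ℝ) = 16 * (dq n : ℝ) ^ 4 := by push_cast; ring
    linarith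
  -- `sqrt n` and `Tq n`
  have hs1000 : 1000 ≤ Nat.sqrt n := by
    rw [Nat.le_sqrt]
    have : dq n ≤ Nat.sqrt n := Nat.sqrt_le_self _
    nlinarith
  have hss : Nat.sqrt n * Nat.sqrt n ≤ n := Nat.sqrt_le n
  have hs200 : 1000 * Nat.sqrt n ≤ n := by nlinarith
  have hTq : T ≤ 4 * Nat.sqrt n + 3 := hTT
  have hT200 : 200 * T ≤ n := by omega
  have hT49 : T * T ≤ 49 * n := by nlinarith
  -- the core size `q`
  obtain ⟨q, hq⟩ : ∃ q : ℕ, q = ⌈a * dq n⌉₊ + 4 := ⟨_, rfl⟩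
  have hq1 : a * dq n + 5 ≤ (q : ℝ) + 1 := by
    rw [hq]; push_cast; linarith [Nat.le_ceil (a * dq n)]
  have hq2 : (q : ℝ) + 1 ≤ a * dq n + 6 := by
    rw [hq]; push_cast
    have := Nat.ceil_lt_add_one (show 0 ≤ a * dq n by positivity); linarith
  have hq80 : 80 * q < dq n + 480 := by
    have hcd : c₀ * dq n ≤ dq n := by nlinarith [Nat.cast_nonneg (α := ℝ) (dq n)]
    have h1 : (80 : ℝ) * q < dq n + 480 := by rw [ha] at hq2; linarith
    exact_mod_cast h1
  have hq84 : 84 ≤ q := by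
    have h1 : (80 : ℝ) ≤ a * dq n := by rw [ha]; linarith
    have h2 : (84 : ℝ) ≤ (q : ℝ) := by linarith
    exact_mod_cast h2
  have hq40 : 40 * q ≤ n := by omega
  have h2q : 2 * q ≤ dq n := by omega
  have hn1 : 1 ≤ n := by omega
  -- the design
  have ht2 : 2 * (2 * c' + 1) + 2 ≤ n := hex.2.1
  have hTt : T ≤ 2 * c' + 1 := hex.2.2.1
  have hDg : Dg ≤ 2 * c' := by omega
  have hDg4 : 4 ≤ Dg := by omega
  have hTq2 : T + 2 * q + 2 ≤ 2 * c' + 1 := by omega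
  have hqD : q ≤ Dg := by omega
  have hDq3 : Dg + 2 * q + 3 ≤ 2 * c' + 1 := by omega
  have hqN : 2 * q * q + q ≤ n / 2 := by
    have h1 : q ≤ dq n := by omega
    have h2 : 2 * q * q + q ≤ 3 * (dq n * dq n) := by nlinarith
    have h3 : 6 * (dq n * dq n) ≤ n := by nlinarith
    omega
  have hBv : 0 ≤ Bv := (sum_nonneg fun c _ => abs_nonneg (w c)).trans hex.2.2.2.2.2.2
  -- the junk threshold `β = exp(−c₀(D−1))`
  have hβ' : ∀ m : ℕ, n ≤ m + 2 * q → Real.exp (-(c₀ * dq m)) ≤ Real.exp (-(c₀ * ((dq n : ℝ) - 1))) := by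
    intro m hm1
    have hdm : dq n - 1 ≤ dq m := dq_pred_le (n := n) hm1 h2q (by omega)
    apply Real.exp_le_exp.2
    have h3 : ((dq n : ℝ) - 1) ≤ (dq m : ℝ) := by
      have : ((dq n - 1 : ℕ) : ℝ) ≤ dq m := by exact_mod_cast hdm
      rwa [Nat.cast_sub (by omega), Nat.cast_one] at this
    nlinarith
  have hβ : ∀ m : ℕ, n ≤ m + 2 * q → m ≤ n → Real.exp (-(c₀ * dq m)) ≤ Real.exp (-(c₀ * ((dq n : ℝ) - 1))) :=
    fun m hm _ => hβ' m hm
  -- the exp-scale dense non-crossing psd cell (hypothesis) as brick 52's `hH` with `n₁ := n − 2q`, `τ = e`, `Ψ := β = e^{−c₀(dq n − 1)}`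
  have hΨ0 : 0 ≤ Real.exp (-(c₀ * ((dq n : ℝ) - 1))) := (Real.exp_pos _).le
  have hC3 : ∀ c ∈ C, Odd c ∧ 3 ≤ c ∧ c ≤ T := fun c hc => ⟨(hex.2.2.2.1 c hc).1, (hex.2.2.2.1 c hc).2.1, (hex.2.2.2.1 c hc).2.2.1⟩
  have hH := fun (m t'' D' : ℕ) (w' : ℕ → ℝ) (hm : n - 2 * q ≤ m) (hme : Even m) (hto : Odd t'') (h5 : m ≤ 5 * t'')
      (h5' : m ≤ 5 * (m - t'')) (hT1 : T ≤ t'') (hT2 : T ≤ m - t'') (hD1 : D' + 3 ≤ t'') (hD2' : D' + 3 ≤ m - t'')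
      (hDq' : Dg ≤ D' + q) (hD'Dg : D' ≤ Dg) (hQ : ∀ c ∈ C, (Qset m t'' c).Nonempty)
      (hexact' : ∀ p : Polynomial ℝ, p.natDegree ≤ D' → ∑ c ∈ C, w' c * p.eval (c : ℝ) = -p.eval 0)
      (hvar' : ∑ c ∈ C, |w' c| ≤ Bv) (X' : OddSet m → Matrix (Fin r) (Fin r) ℝ) (Y' : PMatch m → Matrix (Fin r) (Fin r) ℝ)
      (hX'Y' : IsPsdRect X' Y') (A' : Finset (OddSet m)) (hA' : ∀ U ∈ A', U.1.card = t'') (B' : Finset (PMatch m))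
      (hhom : IsRelHomogeneousW (Real.exp 1) (perfectMatchings (univ : Finset (Fin m)))
        (fun M : Finset (Sym2 (Fin m)) => if hM : IsPMOn univ M then (Y' ⟨M, hM⟩).trace / r else 0) (B'.image Subtype.val))
      (hdX : Real.exp (-(c₀ * dq m)) ≤ (∑ U ∈ A', (X' U).trace) / ((r : ℝ) * (m.choose t'' : ℝ)))
      (hdY : Real.exp (-(c₀ * dq m)) ≤ (∑ M ∈ B', (Y' M).trace) / ((r : ℝ) * (Fintype.card (PMatch m) : ℝ))) =>
    (hred n q Dg T Bv C hC3 hT49 hT200 hq40 h2q hDgD (by omega) (by omega) m t'' D' w' (by omega) (by omega) hme hto h5 h5'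
      hT1 hT2 hD1 hD2' hDq' hD'Dg hQ hexact' hvar' r hPr X' Y' hX'Y' A' hA' B' hhom hdX hdY).trans
      (mul_le_mul_of_nonneg_right (mul_le_mul_of_nonneg_left (hβ' m (by omega)) hBv) (Nat.cast_nonneg r))
  -- the three-term bound in `TracialValueLEAt` form
  have h3 := tracialValueLEAt_of_psdDenseCell (n₁ := n - 2 * q) hev hn1 hr hex hDg hDg4 hbal hq40 (by omega) hTq2 hqD hDq3 hqN hτ1 hH hΨ0 hβ
    (Real.exp_pos _).le
  -- the attenuation `P_{Dg−4}`
  have hDpos : (0 : ℝ) < dq n := by exact_mod_cast (show 0 < dq n by omega)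
  have hn0 : (0 : ℝ) < n := by exact_mod_cast (show 0 < n by omega)
  have hD4R : (dq n : ℝ) ^ 4 ≤ n := by exact_mod_cast hD4n
  have hκ : 18 * q + 18 ≤ (Dg - 4) / 2 + 1 := by omega
  have hκn : 4 * ((Dg - 4) / 2 + 1) ≤ n := by omega
  have hP := atten_le_pow (n := n) hκn
  have hP0 : 0 ≤ ∏ i ∈ range ((Dg - 4) / 2 + 1), ((2 * i + 1 : ℝ) / ((n : ℝ) - 2 * i)) := atten_nonneg (by omega)
  have hratio : ∀ κ : ℕ, 4 * κ ≤ 2 * dq n → (4 * (κ : ℝ)) / n ≤ 2 / (dq n : ℝ) ^ 3 := by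
    intro κ hκ2D
    rw [div_le_div_iff₀ hn0 (by positivity)]
    have h1 : (4 * (κ : ℝ)) ≤ 2 * dq n := by exact_mod_cast hκ2D
    calc 4 * (κ : ℝ) * (dq n : ℝ) ^ 3 ≤ 2 * dq n * (dq n : ℝ) ^ 3 := mul_le_mul_of_nonneg_right h1 (by positivity)
      _ = 2 * (dq n : ℝ) ^ 4 := by ring
      _ ≤ 2 * n := by linarith
  have hP' : (∏ i ∈ range ((Dg - 4) / 2 + 1), ((2 * i + 1 : ℝ) / ((n : ℝ) - 2 * i))) * (dq n : ℝ) ^ (3 * ((Dg - 4) / 2 + 1)) ≤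
      (2 : ℝ) ^ ((Dg - 4) / 2 + 1) := by
    have hr' := hratio ((Dg - 4) / 2 + 1) (by omega)
    have hP2 := hP.trans (pow_le_pow_left₀ (by positivity) (by push_cast at hr' ⊢; exact hr') _)
    calc _ ≤ (2 / (dq n : ℝ) ^ 3) ^ ((Dg - 4) / 2 + 1) * (dq n : ℝ) ^ (3 * ((Dg - 4) / 2 + 1)) :=
          mul_le_mul_of_nonneg_right hP2 (by positivity)
      _ = (2 : ℝ) ^ ((Dg - 4) / 2 + 1) := by
          rw [div_pow, ← pow_mul, div_mul_cancel₀]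
          exact pow_ne_zero _ hDpos.ne'
  -- the four terms
  have hT1 := remainder_term_le hq1
  have hT2 := crossing_term_le (a := a) hP0 hP' (by omega : 2 ≤ dq n) hn16 hκ (by linarith)
  have hq2' : (q : ℝ) + 1 ≤ c₀ / 80 * dq n + 6 := by rw [ha] at hq2; exact hq2
  have hT3 := junk_term_le' (D := (dq n : ℝ)) hc₀1 (by linarith) hq2'
  rw [← ha] at hT3
  have hsum : (Real.exp 1 ^ (q + 1))⁻¹ + Real.exp 1 ^ (q + 1) * (n : ℝ) ^ q *
        ((4 : ℝ) ^ q * Real.sqrt (∏ j ∈ range ((Dg - 4) / 2 + 1), ((2 * j + 1 : ℝ) / ((n : ℝ) - 2 * j)))) +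
        2 * (4 : ℝ) ^ q * Real.exp 1 ^ (q + 1) * (Real.exp (-(c₀ * ((dq n : ℝ) - 1))) + Real.exp (-(c₀ * ((dq n : ℝ) - 1)))) ≤
      Real.exp (-(a * dq n)) := by
    have hT3' : 2 * (4 : ℝ) ^ q * Real.exp 1 ^ (q + 1) * Real.exp (-(c₀ * ((dq n : ℝ) - 1))) ≤ Real.exp (-(a * dq n)) / 6 := hT3
    have hdist : 2 * (4 : ℝ) ^ q * Real.exp 1 ^ (q + 1) * (Real.exp (-(c₀ * ((dq n : ℝ) - 1))) + Real.exp (-(c₀ * ((dq n : ℝ) - 1)))) =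
        2 * (2 * (4 : ℝ) ^ q * Real.exp 1 ^ (q + 1) * Real.exp (-(c₀ * ((dq n : ℝ) - 1)))) := by ring
    rw [hdist]
    linarith [hT1, hT2, hT3', Real.exp_pos (-(a * dq n))]
  exact fun X Y hXY => (h3 X Y hXY).trans (mul_le_mul_of_nonneg_left hsum hBv)

/-! ### §2 The crux by name, from its exp-scale dense non-crossing psd cell inside the budget -/

/-- **THE CRUX `TracialDecayExp20` FOLLOWS FROM ITS EXP-SCALE DENSE NON-CROSSING PSD CELL INSIDE THE BUDGET `r²·n < exp(a₁·dq n)`** (any fixed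
`a₁ > 0`): value `≤ 20·e^{−c₀·dq m}·r` for tight psd strategies of the reduced instances with (PM_m, e)-homogeneous trace weight and both trace densities
`≥ e^{−c₀·dq m}` implies the route's crux, with decay rate `min(c₀/160, a₁)`. [cite: Rothvoss2017, §2 and Lemma 7 (PDF pp. 6–8)]
[cite: KupavskiiZakharov2022, Lemma 11] [cite: BrietDadushPokutta2014, Thm. 6 (§3)] -/
theorem tracialDecayExp20_of_psdDenseCellExp {a₁ : ℝ} (ha₁ : 0 < a₁)
    (hred : ∃ c₀ : ℝ, 0 < c₀ ∧ c₀ ≤ 1 ∧ ∃ n₀ : ℕ, ∀ (n q Dg T : ℕ) (Bv : ℝ) (C : Finset ℕ),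
      (∀ c ∈ C, Odd c ∧ 3 ≤ c ∧ c ≤ T) → T * T ≤ 49 * n → 200 * T ≤ n → 40 * q ≤ n → 2 * q ≤ dq n → Dg ≤ dq n → 1 ≤ dq n →
      4 * dq n + 8 ≤ n →
      ∀ (m t'' D' : ℕ) (w' : ℕ → ℝ), n₀ ≤ m → n ≤ m + 2 * q → Even m → Odd t'' → m ≤ 5 * t'' → m ≤ 5 * (m - t'') →
      T ≤ t'' → T ≤ m - t'' → D' + 3 ≤ t'' → D' + 3 ≤ m - t'' → Dg ≤ D' + q → D' ≤ Dg →
      (∀ c ∈ C, (Qset m t'' c).Nonempty) →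
      (∀ p : Polynomial ℝ, p.natDegree ≤ D' → ∑ c ∈ C, w' c * p.eval (c : ℝ) = -p.eval 0) →
      ∑ c ∈ C, |w' c| ≤ Bv →
      ∀ (r : ℕ), (r : ℝ) ^ 2 * n < Real.exp (a₁ * (dq n : ℝ)) →
      ∀ (X' : OddSet m → Matrix (Fin r) (Fin r) ℝ) (Y' : PMatch m → Matrix (Fin r) (Fin r) ℝ), IsPsdRect X' Y' →
      ∀ (A' : Finset (OddSet m)), (∀ U ∈ A', U.1.card = t'') → ∀ (B' : Finset (PMatch m)),
      IsRelHomogeneousW (Real.exp 1) (perfectMatchings (univ : Finset (Fin m)))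
        (fun M : Finset (Sym2 (Fin m)) => if hM : IsPMOn univ M then (Y' ⟨M, hM⟩).trace / r else 0) (B'.image Subtype.val) →
      Real.exp (-(c₀ * dq m)) ≤ (∑ U ∈ A', (X' U).trace) / ((r : ℝ) * (m.choose t'' : ℝ)) →
      Real.exp (-(c₀ * dq m)) ≤ (∑ M ∈ B', (Y' M).trace) / ((r : ℝ) * (Fintype.card (PMatch m) : ℝ)) →
      ∑ U ∈ A', ∑ M ∈ B', levelWeight m t'' C w' U M * (X' U * Y' M).trace ≤ Bv * Real.exp (-(c₀ * dq m)) * r) :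
    Summit.PneNP.PneNP.Theses.ChebyshevTracialDesign.TracialDecayExp20 := by
  obtain ⟨a, ha, n₁, h⟩ := tracialDecayExp_of_psdDenseCellExpP (fun n r => (r : ℝ) ^ 2 * n < Real.exp (a₁ * (dq n : ℝ))) hred
  obtain ⟨D₂, hD₂⟩ : ∃ D₂ : ℕ, D₂ = ⌈10 / a⌉₊ := ⟨_, rfl⟩
  have hb0 : 0 < min (a / 2) a₁ := lt_min (by positivity) ha₁
  refine ⟨min (a / 2) a₁, hb0, max n₁ (D₂ ^ 4), fun n hn hev t C w hdes r hr hbud => ?_⟩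
  have hn₁ : n₁ ≤ n := le_trans (le_max_left _ _) hn
  have hD₂n : D₂ ^ 4 ≤ n := le_trans (le_max_right _ _) hn
  have hD : D₂ ≤ dq n := by
    unfold dq
    rw [Nat.le_sqrt, Nat.le_sqrt]
    calc D₂ * D₂ * (D₂ * D₂) = D₂ ^ 4 := by ring
      _ ≤ n := hD₂n
  have haD : 10 ≤ a * dq n := by
    have h1 : 10 / a ≤ (dq n : ℝ) := (Nat.le_ceil _).trans (by rw [← hD₂]; exact_mod_cast hD)
    rwa [div_le_iff₀ ha, mul_comm] at h1
  have hD0 : (0 : ℝ) ≤ dq n := Nat.cast_nonneg _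
  -- the crux's budget implies the side condition
  have hP : (r : ℝ) ^ 2 * n < Real.exp (a₁ * (dq n : ℝ)) :=
    hbud.trans_le (Real.exp_le_exp.2 (mul_le_mul_of_nonneg_right (min_le_right _ _) hD0))
  obtain ⟨hex, hbal⟩ := hdes
  obtain ⟨c', hc'⟩ := hex.1
  rw [hc'] at hex hbal ⊢
  have hval := h n hn₁ hev c' (Tq n) (dq n) 20 C w hex hbal le_rfl (by omega) le_rfl r hr hP
  refine fun X Y hXY => (hval X Y hXY).trans ?_
  -- `20·exp(−a D) ≤ exp(−min(a/2, a₁) D)` once `a D ≥ 10`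
  have h20 : (20 : ℝ) ≤ Real.exp (a / 2 * dq n) := by
    have h2 : (2 : ℝ) ≤ Real.exp 1 := by linarith [Real.add_one_le_exp (1 : ℝ)]
    have h5 : (2 : ℝ) ^ 5 ≤ Real.exp 1 ^ 5 := pow_le_pow_left₀ (by norm_num) h2 5
    have h5' : Real.exp 1 ^ 5 = Real.exp 5 := by rw [← Real.exp_nat_mul]; norm_num
    rw [h5'] at h5
    norm_num at h5
    exact le_trans (by linarith) (Real.exp_le_exp.2 (by linarith : (5 : ℝ) ≤ a / 2 * dq n))
  have hmin : Real.exp (-(a / 2 * (dq n : ℝ))) ≤ Real.exp (-(min (a / 2) a₁ * (dq n : ℝ))) :=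
    Real.exp_le_exp.2 (by nlinarith [min_le_left (a / 2) a₁])
  have hsplit : Real.exp (-(a / 2 * (dq n : ℝ))) = Real.exp (a / 2 * dq n) * Real.exp (-(a * (dq n : ℝ))) := by
    rw [← Real.exp_add]; congr 1; ring
  refine le_trans ?_ hmin
  rw [hsplit]
  exact mul_le_mul_of_nonneg_right h20 (Real.exp_pos _).le

end Summit.PneNP.PneNP.Theorems.ChebyshevTracialDesignPsdCruxExp
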